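import Literature.Computability.Complexity.Transducers
import Literature.Computability.Complexity.TM2Iterate
import Literature.Computability.Complexity.UnaryArithMachines
import Literature.Computability.Complexity.ReductionsProofs
import HarnessLib

/-!
# Polynomially many iterations of an `FP` function are in `FP` (clocked iteration as a string-function combinator)

Trunk `CplxCore`, toolkit for `TimeBounds.lean`. The machine combinator
`PolyTimeComputable.iterate_of_le_add` (`TM2Iterate.lean`: `(a, n) ↦ F^[n] a` on the input word
`noneⁿ ++ (ea a).map some`) packaged at the level of `FP` string functions, in the shape in which
loops occur in reductions: **iterate `F ∈ FP` for `p(|x|)` rounds**, where `x` is the first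
component of the (pair-coded) current word and `p` a polynomial —

* `iterate_mem_FP`: for `F ∈ FP` with additive growth `|F w| ≤ |w| + d`,
  `z ↦ F^[p(|(boolUnpair z).1|)] z` is in `FP`.

The clock is produced by the unary arithmetic of `UnaryArithMachines.lean`
(`evalHdrFn p z = 1^{|x|} 0 1^{p|x|} 0 z`) and recoded by the three-state transducer `itInit`
(`1ⁿ 0 1ᵃ 0 z ↦ noneᵃ ++ z.map some`, `itInit_eval`), exactly as in `LengthCompare.lean` /
`StringEquality.lean`, whose loops are instances. Typical use: a round function that keeps the
instance `x` in the first component and updates a state in the second (`F ⟨x, s⟩ = ⟨x, G x s⟩`).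

## References

* S. Arora, B. Barak, *Computational Complexity: A Modern Approach*, CUP 2009, §1.4.1 (clocked
  simulation: a time counter drives a loop of a fixed machine), §1.3.
-/

namespace Literature.Computability.Complexity

open _root_.Computability

/-! ### The recoding transducer -/

/-- States of `itInit`: skipping the first unary block, recoding the clock block, copying the
payload. [folklore] -/
inductive ItS
  | skip
  | cnt
  | tl
  deriving DecidableEq, Fintype

/-- Transition of `itInit`. [folklore] -/
def itInitStep : ItS → Bool → ItS × List (Option Bool)
  | .skip, true => (.skip, [])
  | .skip, false => (.cnt, [])
  | .cnt, true => (.cnt, [none])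
  | .cnt, false => (.tl, [])
  | .tl, b => (.tl, [some b])

/-- The recoding transducer `1ⁿ 0 1ᵃ 0 z ↦ noneᵃ ++ z.map some`. [folklore] -/
def itInit : FST ItS Bool (Option Bool) where
  init := .skip
  step := itInitStep
  front := fun _ => []
  keep := fun _ => true

/-- The transition of `itInit` (definitional). [folklore] -/
@[simp] theorem itInit_step (s : ItS) (b : Bool) : itInit.step s b = itInitStep s b := rfl

/-- Payload/count decomposition of the output of `itInit` on an arbitrary input: skip the first
unary block, the second is the count, the rest is the payload. [folklore] -/
def stageIt (w : List Bool) : List Bool × ℕ :=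
  ((splitOnes (splitOnes w).2).2, (splitOnes (splitOnes w).2).1)

/-- From `tl` the payload is copied as `some`s. [folklore] -/
theorem itInit_run_tl (w : List Bool) : (itInit.run .tl w).2 = w.map some := by
  induction w with
  | nil => rfl
  | cons b w ih => simp [FST.run_cons, itInitStep, ih]

/-- From `cnt`: the clock as `none`s, then the payload. [folklore] -/
theorem itInit_run_cnt (w : List Bool) :
    (itInit.run .cnt w).2 = List.replicate (splitOnes w).1 none ++ ((splitOnes w).2).map some := by
  induction w with
  | nil => rfl
  | cons b w ih =>
    cases b
    · simp [FST.run_cons, itInitStep, splitOnes, itInit_run_tl]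
    · simp [FST.run_cons, itInitStep, splitOnes, ih, List.replicate_succ]

/-- **Shape of the output of `itInit` on every input.** [folklore] -/
theorem itInit_eval (w : List Bool) :
    itInit.eval w = List.replicate (stageIt w).2 none ++ ((stageIt w).1).map some := by
  have h : ∀ w : List Bool, (itInit.run .skip w).2 =
      List.replicate (stageIt w).2 none ++ ((stageIt w).1).map some := by
    intro w
    induction w with
    | nil => rfl
    | cons b w ih =>
      cases b
      · simp [FST.run_cons, itInitStep, stageIt, splitOnes, itInit_run_cnt]
      · simpa [FST.run_cons, itInitStep, stageIt, splitOnes] using ih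
  have he : itInit.eval w = (itInit.run .skip w).2 := by simp [FST.eval, itInit]
  rw [he, h w]

/-- On `1ⁿ 0 1ᵃ 0 z` the decomposition is `(z, a)`. [folklore] -/
theorem stageIt_hdr (n a : ℕ) (z : List Bool) : stageIt (hdr n a z) = (z, a) := by
  simp [stageIt, hdr]

/-- `stageIt` is polynomial-time computable into the input encoding of the iteration combinator.
[folklore] -/
theorem polyTimeComputable_stageIt :
    PolyTimeComputable (id : List Bool → List Bool)
      (fun q : List Bool × ℕ => List.replicate q.2 none ++ (id q.1).map some) stageIt := by
  obtain ⟨p, M, hM⟩ := itInit.polyTimeComputable_eval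
  refine ⟨p, M, fun w => ?_⟩
  have h := hM w
  simp only [id, itInit_eval] at h ⊢
  exact h

/-! ### The combinator -/

/-- **Polynomially many rounds of an `FP` function are in `FP`.** If `F ∈ FP` grows its argument
by at most `d` symbols per application, then for every polynomial `p` the function
`z ↦ F^[p(|(boolUnpair z).1|)] z` is in `FP`: lay out the clock `1^{|x|} 0 1^{p|x|} 0 z`
(`evalHdrFn`), recode it (`stageIt`), and run the clocked iteration of the machine of `F`
(`PolyTimeComputable.iterate_of_le_add`). [Arora–Barak 2009, §1.4.1]
[cite: AroraBarakCC2009, §1.4.1] -/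
theorem iterate_mem_FP {F : List Bool → List Bool} (hF : F ∈ FP) (d : ℕ)
    (hd : ∀ w, (F w).length ≤ w.length + d) (p : Polynomial ℕ) :
    (fun z => F^[p.eval (boolUnpair z).1.length] z) ∈ FP := by
  have h3 : PolyTimeComputable (fun q : List Bool × ℕ => List.replicate q.2 none ++ (id q.1).map some)
      (id : List Bool → List Bool) (fun q => F^[q.2] q.1) :=
    PolyTimeComputable.iterate_of_le_add (ea := (id : List Bool → List Bool)) d (fun w => by simpa using hd w) hF
  have h := PolyTimeComputable.comp_holds h3
    (PolyTimeComputable.comp_holds polyTimeComputable_stageIt (evalHdrFn_mem_FP p))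
  have heq : ((fun q : List Bool × ℕ => F^[q.2] q.1) ∘ stageIt ∘ evalHdrFn p) =
      fun z => F^[p.eval (boolUnpair z).1.length] z := by
    funext z
    simp [Function.comp_apply, evalHdrFn, stageIt_hdr]
  rw [heq] at h
  exact h

end Literature.Computability.Complexity
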